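import Summits.RiemannHypothesis.RiemannHypothesis.Theses.RuelleBand
import HarnessLib

/-!
# `ZetaWeakRecurrence` (crux stmt-RiemannHypothesis-18110, route RuelleBand) — rigidity of the height quantifier

Negative-side support file of the crux disprover (cdisprove seat, cycle 1). The lateness clause `T ≤ τ` of WR
carries all its content, but RIGIDLY:

* `zeta_recurrence_without_lateness_trivial` — without it the statement is trivial (`τ = 0`);
* `zeta_shift_period_eq_zero` — `ζ` has NO VERTICAL PERIOD on any disc of `{Re s < 1}`: `ζ(s + iτ) = ζ(s)` on a
  closed disc of positive radius forces `τ = 0` (identity theorem on `ℂ ∖ {1, 1 − iτ}`, then the pole at `1`,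
  Mathlib `riemannZeta_residue_one`, against continuity of `ζ` at `1 + iτ`);
* `zetaWeakRecurrence_iff_oneLateReturn` — WR is EQUIVALENT to asking, per disc and per `ε`, for ONE return at
  ANY height `≥ 1`: returns trapped below a height `T₀` for all `ε` accumulate (compactness of `[1, T₀]`) at an
  exact vertical period. Reading: WR ⟺ "`ζ|_D` is not isolated in `{ζ(·+iτ)|_D : τ ≥ 1}` for the sup norm" —
  a statement about the closure of ONE orbit tail; no infinitude, density or height bookkeeping is needed, and
  the natural strengthening `∃ τ ∀ ε` (exact period) is false.
-/


noncomputable section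

open Complex Set Metric Filter Topology

namespace Summit.RiemannHypothesis.RiemannHypothesis.Theorems.ZetaWeakRecurrence.Negative

open Summit.RiemannHypothesis.RiemannHypothesis.Theses.RuelleBand

/-- Without the lateness clause `T ≤ τ` the recurrence statement is TRIVIAL (`τ = 0`). [folklore] -/
theorem zeta_recurrence_without_lateness_trivial (z : ℂ) (r : ℝ) {ε : ℝ} (hε : 0 < ε) :
    ∃ τ : ℝ, ∀ s ∈ closedBall z r, ‖riemannZeta (s + τ * I) - riemannZeta s‖ < ε :=
  ⟨0, fun s _ => by simpa using hε⟩

/-- `ζ` has NO VERTICAL PERIOD: if `ζ(s + iτ) = ζ(s)` on a closed disc of positive radius inside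
`{Re s < 1}`, then `τ = 0` (identity theorem on `ℂ ∖ {1, 1 − iτ}`, then the pole at `1` against
continuity at `1 + iτ`). [folklore] -/
theorem zeta_shift_period_eq_zero {z : ℂ} {r : ℝ} (hr : 0 < r) (hz : z.re + r < 1) {τ : ℝ}
    (h : ∀ s ∈ closedBall z r, riemannZeta (s + τ * I) = riemannZeta s) : τ = 0 := by
  by_contra hτ
  set f : ℂ → ℂ := fun w => riemannZeta (w + τ * I) - riemannZeta w with hf
  set U : Set ℂ := ({1, 1 - τ * I} : Set ℂ)ᶜ with hU
  have hUfin : ({1, 1 - τ * I} : Set ℂ).Finite := (Set.finite_singleton _).insert 1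
  have hUo : IsOpen U := hUfin.isClosed.isOpen_compl
  have hdiff : DifferentiableOn ℂ f U := by
    intro w hw
    have hw1 : w ≠ 1 := fun h1 => hw (by simp [h1])
    have hw2 : w + τ * I ≠ 1 := fun h1 => hw (by
      have : w = 1 - τ * I := by linear_combination h1
      simp [this])
    exact (((differentiableAt_riemannZeta hw2).comp w (differentiableAt_id.add_const _)).sub
      (differentiableAt_riemannZeta hw1)).differentiableWithinAt
  have han : AnalyticOnNhd ℂ f U := hdiff.analyticOnNhd hUo
  have hpre : IsPreconnected U :=
    (Set.Countable.isPathConnected_compl_of_one_lt_rank (by simp)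
      hUfin.countable).isConnected.isPreconnected
  have hzU : z ∈ U := by
    intro hz'
    rcases hz' with h1 | h2
    · have := congrArg Complex.re h1
      simp at this
      linarith
    · have := congrArg Complex.re h2
      simp at this
      linarith
  have hfreq : ∃ᶠ w in 𝓝[≠] z, f w = 0 := by
    apply Filter.Eventually.frequently
    have hev : ∀ᶠ w in 𝓝 z, f w = 0 := by
      rw [Metric.eventually_nhds_iff]
      exact ⟨r, hr, fun w hw => sub_eq_zero.2 (h w (Metric.mem_closedBall.2 hw.le))⟩
    exact hev.filter_mono nhdsWithin_le_nhds
  have hEq := han.eqOn_zero_of_preconnected_of_frequently_eq_zero hpre hzU hfreq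
  -- the pole at `1` against continuity at `1 + iτ`
  have hne : (1 : ℂ) - τ * I ≠ 1 := by
    intro h1
    have := congrArg Complex.im h1
    simp at this
    exact hτ this
  have h1U : ∀ᶠ w in 𝓝[≠] (1 : ℂ), w ∈ U := by
    have h2 : ∀ᶠ w in 𝓝 (1 : ℂ), w ≠ 1 - τ * I := eventually_ne_nhds hne.symm
    filter_upwards [self_mem_nhdsWithin, h2.filter_mono nhdsWithin_le_nhds] with w hw1 hw2
    simp only [hU, Set.mem_compl_iff, Set.mem_insert_iff, Set.mem_singleton_iff, not_or]
    exact ⟨hw1, hw2⟩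
  have hev : (fun w => (w - 1) * riemannZeta w) =ᶠ[𝓝[≠] (1 : ℂ)]
      fun w => (w - 1) * riemannZeta (w + τ * I) := by
    filter_upwards [h1U] with w hw
    have h0 : f w = 0 := hEq hw
    simp only [hf, sub_eq_zero] at h0
    rw [h0]
  have hlim1 : Tendsto (fun w => (w - 1) * riemannZeta w) (𝓝[≠] 1) (𝓝 1) :=
    riemannZeta_residue_one
  have h1τ : (1 : ℂ) + τ * I ≠ 1 := by
    intro h1
    have := congrArg Complex.im h1
    simp at this
    exact hτ this
  have hlim2 : Tendsto (fun w => (w - 1) * riemannZeta (w + τ * I)) (𝓝[≠] (1 : ℂ)) (𝓝 0) := by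
    have hc1 : ContinuousAt (fun w : ℂ => riemannZeta (w + τ * I)) 1 :=
      ((differentiableAt_riemannZeta h1τ).comp 1 (differentiableAt_id.add_const _)).continuousAt
    have hc : ContinuousAt (fun w : ℂ => (w - 1) * riemannZeta (w + τ * I)) 1 :=
      (continuousAt_id.sub continuousAt_const).mul hc1
    have := hc.tendsto
    simp only [sub_self, zero_mul] at this
    exact this.mono_left nhdsWithin_le_nhds
  exact one_ne_zero (tendsto_nhds_unique_of_eventuallyEq hlim1 hlim2 hev)

/-- RIGIDITY OF THE HEIGHT QUANTIFIER: WR is equivalent to asking, for each disc and each `ε`,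
for ONE return at ANY height `≥ 1` (a fixed positive threshold). Reason: returns trapped below a
height `T₀` for all `ε` would accumulate (compactness of `[1, T₀]`) at an EXACT vertical period of
`ζ` on the disc, excluded by `zeta_shift_period_eq_zero`. So WR says exactly: "`ζ|_D` lies in the
sup-norm closure of `{ζ(· + iτ)|_D : τ ≥ 1}`" — one non-trivial approximate return per `ε`. -/
theorem zetaWeakRecurrence_iff_oneLateReturn :
    ZetaWeakRecurrence ↔ ∀ (z : ℂ) (r : ℝ), 0 < r → r < min (z.re - 1 / 2) (1 - z.re) →
      ∀ ε : ℝ, 0 < ε → ∃ τ : ℝ, 1 ≤ τ ∧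
        ∀ s ∈ closedBall z r, ‖riemannZeta (s + τ * I) - riemannZeta s‖ < ε := by
  refine ⟨fun h z r hr hrmin ε hε => h z r hr hrmin ε hε 1, fun h z r hr hrmin ε hε T => ?_⟩
  by_contra hcon
  push Not at hcon
  have hz1 : z.re + r < 1 := by
    have := hrmin.trans_le (min_le_right _ _); linarith
  -- returns at level `min ε (1/(n+1))`, all trapped in `[1, T]`
  have hret : ∀ n : ℕ, ∃ τ : ℝ, 1 ≤ τ ∧ τ ≤ T ∧
      ∀ s ∈ closedBall z r, ‖riemannZeta (s + τ * I) - riemannZeta s‖ < 1 / ((n : ℝ) + 1) := by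
    intro n
    obtain ⟨τ, hτ1, hτ⟩ := h z r hr hrmin (min ε (1 / ((n : ℝ) + 1))) (lt_min hε (by positivity))
    refine ⟨τ, hτ1, ?_, fun s hs => (hτ s hs).trans_le (min_le_right _ _)⟩
    by_contra hT
    push Not at hT
    obtain ⟨s, hs, hle⟩ := hcon τ hT.le
    exact absurd ((hτ s hs).trans_le (min_le_left _ _)) (not_lt.2 hle)
  choose τ hτ1 hτT hτret using hret
  obtain ⟨τ₀, hτ₀mem, φ, hφ, hlim⟩ :=
    isCompact_Icc.tendsto_subseq (fun n => (⟨hτ1 n, hτT n⟩ : τ n ∈ Icc (1 : ℝ) T))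
  -- the limit shift is an exact period of `ζ` on the disc
  have hperiod : ∀ s ∈ closedBall z r, riemannZeta (s + τ₀ * I) = riemannZeta s := by
    intro s hs
    have hs1 : ∀ t : ℝ, s + t * I ≠ 1 := by
      intro t h1
      have := congrArg Complex.re h1
      simp at this
      rw [mem_closedBall, dist_eq_norm] at hs
      have h2 := (abs_re_le_norm (s - z)).trans hs
      rw [sub_re, abs_le] at h2
      linarith [h2.2]
    have hg : Continuous fun t : ℝ => riemannZeta (s + t * I) := by
      refine continuous_iff_continuousAt.2 fun t => ?_
      have hc : Continuous fun t : ℝ => s + (t : ℂ) * I := by fun_prop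
      exact ContinuousAt.comp (g := riemannZeta) (f := fun t : ℝ => s + (t : ℂ) * I)
        (differentiableAt_riemannZeta (hs1 t)).continuousAt hc.continuousAt
    have hlim1 : Tendsto (fun n => ‖riemannZeta (s + τ (φ n) * I) - riemannZeta s‖) atTop
        (𝓝 ‖riemannZeta (s + τ₀ * I) - riemannZeta s‖) :=
      (((hg.tendsto τ₀).comp hlim).sub_const (riemannZeta s)).norm
    have hlim0 : Tendsto (fun n => ‖riemannZeta (s + τ (φ n) * I) - riemannZeta s‖) atTop
        (𝓝 0) := by
      refine squeeze_zero (fun n => norm_nonneg _) (fun n => (hτret (φ n) s hs).le) ?_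
      exact tendsto_one_div_add_atTop_nhds_zero_nat.comp hφ.tendsto_atTop
    have := tendsto_nhds_unique hlim1 hlim0
    rwa [norm_eq_zero, sub_eq_zero] at this
  have h0 := zeta_shift_period_eq_zero hr hz1 hperiod
  have h1 : (1 : ℝ) ≤ τ₀ := hτ₀mem.1
  linarith

end Summit.RiemannHypothesis.RiemannHypothesis.Theorems.ZetaWeakRecurrence.Negative

end
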